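import Summits.Ventures.HodgeRepro.FaceCensusRow12Cyclic
import Summits.Ventures.HodgeRepro.FaceCensusRow12C6C2
import Summits.Ventures.HodgeRepro.Night3CensusBridge

/-!
# The sealed census rows `Duodecic.Cyclic` and `Duodecic.C6C2` cover their faces up to Galois twist (kernel)

Blind re-derivation cell `pub-hodge-repro`, seat `night-3` (gen 3).  Imports p4's proofs of the sealed order-`12` census
rows (`FaceCensusRows12` with their `census` theorems, whose first clause is the group check) and night-3's
`Night3CensusBridge` (`coversFaces`, `coversTypes`, `coversFaces_of_chunks`, the transport `cover_of_coversFaces`).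
Namespace `HodgeRepro.Night3.Census`.

For each row, the cover check `coversFaces Γ reps = true` is decided on the kernel in FOUR CHUNKS of `16` CM types
(`coversTypes` on `take 16` / `drop 16` slices of `Γ.cmTypes`, each a `decide +kernel` within the default heartbeats;
`coversFaces_of_chunks` assembles them), and the transport reads it in the model: every face `(Φ; p, p')` of
`(Elt Γ, conj Γ)` has a corner multiset which is a right twist of the corner multiset of one of the sealed
representatives — the hypothesis `hcover` of night-3's twist reduction (`alg_of_faces_gset_reps`).  Nothing here closes
S4; no sealed file is touched; no Tier-2 item depends on this file.
-/

set_option autoImplicit false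

namespace HodgeRepro.Night3.Census

open Summit.Ventures.HodgeRepro.FaceCensus
open HodgeRepro.EngineBridge

/-! ### Row `Duodecic.Cyclic` — the cyclic duodecic row (20 representatives) -/

/-- The group check of the row, from p4's census theorem. -/
instance factDuodecicCyclic : Fact (Duodecic.Cyclic.Γ.isCMGaloisType = true) := ⟨Duodecic.Cyclic.census.1⟩

/-- Chunk 0 of the cover check (CM types `0`–`15` of `Γ.cmTypes`). -/
theorem coversTypes_duodecicCyclic_0 :
    coversTypes Duodecic.Cyclic.Γ (repTwists Duodecic.Cyclic.Γ Duodecic.Cyclic.reps) (Duodecic.Cyclic.Γ.cmTypes.take 16) = true := by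
  decide +kernel

/-- Chunk 1 of the cover check (CM types `16`–`31`). -/
theorem coversTypes_duodecicCyclic_1 :
    coversTypes Duodecic.Cyclic.Γ (repTwists Duodecic.Cyclic.Γ Duodecic.Cyclic.reps) ((Duodecic.Cyclic.Γ.cmTypes.drop 16).take 16) = true := by
  decide +kernel

/-- Chunk 2 of the cover check (CM types `32`–`47`). -/
theorem coversTypes_duodecicCyclic_2 :
    coversTypes Duodecic.Cyclic.Γ (repTwists Duodecic.Cyclic.Γ Duodecic.Cyclic.reps) (((Duodecic.Cyclic.Γ.cmTypes.drop 16).drop 16).take 16) = true := by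
  decide +kernel

/-- Chunk 3 of the cover check (CM types `48`–`63`). -/
theorem coversTypes_duodecicCyclic_3 :
    coversTypes Duodecic.Cyclic.Γ (repTwists Duodecic.Cyclic.Γ Duodecic.Cyclic.reps) (((Duodecic.Cyclic.Γ.cmTypes.drop 16).drop 16).drop 16) = true := by
  decide +kernel

/-- The cover check of the row `Duodecic.Cyclic` (assembled from the four chunks). -/
theorem coversFaces_duodecicCyclic : coversFaces Duodecic.Cyclic.Γ Duodecic.Cyclic.reps = true :=
  coversFaces_of_chunks Duodecic.Cyclic.Γ Duodecic.Cyclic.reps coversTypes_duodecicCyclic_0 coversTypes_duodecicCyclic_1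
    coversTypes_duodecicCyclic_2 coversTypes_duodecicCyclic_3

/-- **Row `Duodecic.Cyclic`**: every face of the model is a twist of a sealed representative. -/
theorem cover_duodecicCyclic (Φ : Finset (Elt Duodecic.Cyclic.Γ)) (p p' : Elt Duodecic.Cyclic.Γ)
    (hΦ : IsCMType (Elt.conj Duodecic.Cyclic.Γ) Φ) (hp : p' ∉ place (Elt.conj Duodecic.Cyclic.Γ) p) :
    ∃ r ∈ Duodecic.Cyclic.reps, ∃ g : Elt Duodecic.Cyclic.Γ,
      GSet.faceCornersMul (Elt.conj Duodecic.Cyclic.Γ) Φ p p' = (cornersMul Duodecic.Cyclic.Γ r).map fun S => rmul S g :=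
  cover_of_coversFaces Duodecic.Cyclic.Γ Duodecic.Cyclic.reps coversFaces_duodecicCyclic Φ p p' hΦ hp

/-! ### Row `Duodecic.C6C2` — the row `ℤ/6 × ℤ/2` (22 representatives) -/

/-- The group check of the row, from p4's census theorem. -/
instance factDuodecicC6C2 : Fact (Duodecic.C6C2.Γ.isCMGaloisType = true) := ⟨Duodecic.C6C2.census.1⟩

/-- Chunk 0 of the cover check (CM types `0`–`15` of `Γ.cmTypes`). -/
theorem coversTypes_duodecicC6C2_0 :
    coversTypes Duodecic.C6C2.Γ (repTwists Duodecic.C6C2.Γ Duodecic.C6C2.reps) (Duodecic.C6C2.Γ.cmTypes.take 16) = true := by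
  decide +kernel

/-- Chunk 1 of the cover check (CM types `16`–`31`). -/
theorem coversTypes_duodecicC6C2_1 :
    coversTypes Duodecic.C6C2.Γ (repTwists Duodecic.C6C2.Γ Duodecic.C6C2.reps) ((Duodecic.C6C2.Γ.cmTypes.drop 16).take 16) = true := by
  decide +kernel

/-- Chunk 2 of the cover check (CM types `32`–`47`). -/
theorem coversTypes_duodecicC6C2_2 :
    coversTypes Duodecic.C6C2.Γ (repTwists Duodecic.C6C2.Γ Duodecic.C6C2.reps) (((Duodecic.C6C2.Γ.cmTypes.drop 16).drop 16).take 16) = true := by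
  decide +kernel

/-- Chunk 3 of the cover check (CM types `48`–`63`). -/
theorem coversTypes_duodecicC6C2_3 :
    coversTypes Duodecic.C6C2.Γ (repTwists Duodecic.C6C2.Γ Duodecic.C6C2.reps) (((Duodecic.C6C2.Γ.cmTypes.drop 16).drop 16).drop 16) = true := by
  decide +kernel

/-- The cover check of the row `Duodecic.C6C2` (assembled from the four chunks). -/
theorem coversFaces_duodecicC6C2 : coversFaces Duodecic.C6C2.Γ Duodecic.C6C2.reps = true :=
  coversFaces_of_chunks Duodecic.C6C2.Γ Duodecic.C6C2.reps coversTypes_duodecicC6C2_0 coversTypes_duodecicC6C2_1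
    coversTypes_duodecicC6C2_2 coversTypes_duodecicC6C2_3

/-- **Row `Duodecic.C6C2`**: every face of the model is a twist of a sealed representative. -/
theorem cover_duodecicC6C2 (Φ : Finset (Elt Duodecic.C6C2.Γ)) (p p' : Elt Duodecic.C6C2.Γ)
    (hΦ : IsCMType (Elt.conj Duodecic.C6C2.Γ) Φ) (hp : p' ∉ place (Elt.conj Duodecic.C6C2.Γ) p) :
    ∃ r ∈ Duodecic.C6C2.reps, ∃ g : Elt Duodecic.C6C2.Γ,
      GSet.faceCornersMul (Elt.conj Duodecic.C6C2.Γ) Φ p p' = (cornersMul Duodecic.C6C2.Γ r).map fun S => rmul S g :=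
  cover_of_coversFaces Duodecic.C6C2.Γ Duodecic.C6C2.reps coversFaces_duodecicC6C2 Φ p p' hΦ hp

end HodgeRepro.Night3.Census
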